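import Summits.AtomisticToContinuum.BoseEinsteinCondensation.Theses.BECConjugateDomination
import Summits.AtomisticToContinuum.BoseEinsteinCondensation.Theorems.BECConjugateDominationPositiveMinimiserFinal
import Literature.MathematicalPhysics.QuantumManyBody.PeriodicBoseGasLemma32
import Literature.MathematicalPhysics.QuantumManyBody.PeriodicClusteringFromKyFanGap
import Literature.MathematicalPhysics.QuantumManyBody.PeriodicKineticBudget
import Literature.MathematicalPhysics.QuantumManyBody.PeriodicMultiplierKineticBound
import Mathlib.MeasureTheory.Integral.Marginal
import HarnessLib

/-!
# (α'_phys) part 1/4: pair-image geometry, the null contact wall, the shrinking layers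
# — line `third-law-current-floor`, crux `HardCoreExtension` (stmt-AtomisticToContinuum-11786), lead c1

Elementary facts about the pair images `X i - X j - latticeVec L n`: measurability of the pair sets, the hard set and the
penalised interaction (`m · 1_{hard set} ≤ W_{min(v,m)}`, so the core mass of a truncation minimiser is `≤ 𝓔/m`), nullity of
the contact wall (Fubini in one particle + `addHaar_sphere`), and the pigeonhole identity `⋂ₖ layer(1/(k+1)) = wall`. [folklore]
-/

noncomputable section

namespace Summit.AtomisticToContinuum.BoseEinsteinCondensation.Cruxes.HardCoreExtension.ThirdLawCurrentFloor

open MeasureTheory Filter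
open scoped ENNReal NNReal BigOperators Topology
open Literature.MathematicalPhysics.QuantumManyBody.BoseGas
open Summit.AtomisticToContinuum.BoseEinsteinCondensation.Theorems.PositiveMinimiser

namespace AlphaPhys

variable {N : ℕ} {L : ℝ}

/-! ### The pair sets: core, shells, layers, wall -/

/-- The image-pair sets `{X | some image pair distance ∈ S}` are measurable (countable unions of preimages of `S`
under the continuous maps `X ↦ ‖xᵢ − xⱼ − Ln‖`). [folklore] -/
theorem measurableSet_pairImage (L : ℝ) {S : Set ℝ} (hS : MeasurableSet S) :
    MeasurableSet {X : Config N | ∃ i j : Fin N, i ≠ j ∧ ∃ n : Fin 3 → ℤ, ‖X i - X j - latticeVec L n‖ ∈ S} := by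
  have h : {X : Config N | ∃ i j : Fin N, i ≠ j ∧ ∃ n : Fin 3 → ℤ, ‖X i - X j - latticeVec L n‖ ∈ S} =
      ⋃ i : Fin N, ⋃ j : Fin N, ⋃ (_ : i ≠ j), ⋃ n : Fin 3 → ℤ,
        (fun X : Config N => ‖X i - X j - latticeVec L n‖) ⁻¹' S := by
    ext X; simp only [Set.mem_setOf_eq, Set.mem_iUnion, Set.mem_preimage, exists_prop]
  rw [h]
  refine MeasurableSet.iUnion fun i => MeasurableSet.iUnion fun j => MeasurableSet.iUnion fun _ =>
    MeasurableSet.iUnion fun n => ?_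
  exact (((measurable_pi_apply i).sub (measurable_pi_apply j)).sub_const _).norm hS

/-- Off the hard set the interaction only sees the tail, where `v = min(v, m)` once `m ≥ M ≥ v`. [folklore] -/
theorem periodicInteraction_eq_trunc_of_far {v : ℝ → ℝ≥0∞} {a : ℝ} {M : ℝ≥0∞} (hM : ∀ r, a < r → v r ≤ M)
    {m : ℕ} (hm : M ≤ (m : ℝ≥0∞)) (L : ℝ) {X : Config N}
    (hX : ∀ i j : Fin N, i ≠ j → ∀ n : Fin 3 → ℤ, a < ‖X i - X j - latticeVec L n‖) :
    periodicInteraction v L X = periodicInteraction (fun r => min (v r) (m : ℝ≥0∞)) L X := by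
  unfold periodicInteraction periodizedPotential
  refine Finset.sum_congr rfl fun i _ => Finset.sum_congr rfl fun j hj => tsum_congr fun n => ?_
  have hij : i ≠ j := (Finset.mem_filter.1 hj).2.ne
  exact (min_eq_left ((hM _ (hX i j hij n)).trans hm)).symm

/-- On the open hard set (some image pair at distance `< a`, `v = ⊤` on `[0,a)`) the truncated interaction is `≥ m`.
[folklore] -/
theorem natCast_le_periodicInteraction_trunc_of_core {v : ℝ → ℝ≥0∞} {a : ℝ} (hcore : ∀ r, 0 ≤ r → r < a → v r = ⊤)
    (m : ℕ) (L : ℝ) {X : Config N}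
    (hX : ∃ i j : Fin N, i ≠ j ∧ ∃ n : Fin 3 → ℤ, ‖X i - X j - latticeVec L n‖ < a) :
    (m : ℝ≥0∞) ≤ periodicInteraction (fun r => min (v r) (m : ℝ≥0∞)) L X := by
  set w : ℝ → ℝ≥0∞ := fun r => min (v r) (m : ℝ≥0∞) with hw
  -- one ORDERED image pair term is below the whole interaction
  have key : ∀ (i j : Fin N), i < j → ∀ n : Fin 3 → ℤ,
      w ‖X i - X j - latticeVec L n‖ ≤ periodicInteraction w L X := by
    intro i j hlt n
    unfold periodicInteraction
    calc w ‖X i - X j - latticeVec L n‖ ≤ periodizedPotential w L (X i - X j) := by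
          unfold periodizedPotential; exact ENNReal.le_tsum n
      _ ≤ ∑ j' ∈ Finset.univ.filter (fun j' => i < j'), periodizedPotential w L (X i - X j') :=
          Finset.single_le_sum (f := fun j' => periodizedPotential w L (X i - X j')) (fun _ _ => bot_le)
            (Finset.mem_filter.2 ⟨Finset.mem_univ _, hlt⟩)
      _ ≤ ∑ i' : Fin N, ∑ j' ∈ Finset.univ.filter (fun j' => i' < j'), periodizedPotential w L (X i' - X j') :=
          Finset.single_le_sum (f := fun i' => ∑ j' ∈ Finset.univ.filter (fun j' => i' < j'),
            periodizedPotential w L (X i' - X j')) (fun _ _ => bot_le) (Finset.mem_univ _)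
  obtain ⟨i, j, hij, n, hn⟩ := hX
  have hwm : w ‖X i - X j - latticeVec L n‖ = (m : ℝ≥0∞) := by
    rw [hw]; dsimp only; rw [hcore _ (norm_nonneg _) hn, min_eq_right le_top]
  rw [← hwm]
  rcases lt_or_gt_of_ne hij with hlt | hgt
  · exact key i j hlt n
  · -- pass to the pair `(j, i)` and the image `-n`
    have hrev : ‖X j - X i - latticeVec L (-n)‖ = ‖X i - X j - latticeVec L n‖ := by
      rw [latticeVec_neg, ← norm_neg]; congr 1; abel
    rw [← hrev]
    exact key j i hgt (-n)

/-- **Core mass of a penalised minimiser**: if `W ≥ m` on the open hard set `K` (some image pair at distance `< a`, `v = ⊤` on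
`[0,a)`), then `m · ∫_{K ∩ cell} |Ψ|² ≤ 𝓔_{min(v,m)}[Ψ]`. [folklore] -/
theorem mul_coreMass_le_energy {v : ℝ → ℝ≥0∞} {a : ℝ} (hcore : ∀ r, 0 ≤ r → r < a → v r = ⊤) (m : ℕ)
    (Ψ : PeriodicTrialState N L) :
    (m : ℝ≥0∞) * ∫⁻ X in {X : Config N | ∃ i j : Fin N, i ≠ j ∧ ∃ n : Fin 3 → ℤ,
        ‖X i - X j - latticeVec L n‖ < a} ∩ cellN N L, (‖Ψ.ψ X‖₊ : ℝ≥0∞) ^ 2 ≤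
      periodicEnergy (fun r => min (v r) (m : ℝ≥0∞)) Ψ := by
  set K : Set (Config N) := {X : Config N | ∃ i j : Fin N, i ≠ j ∧ ∃ n : Fin 3 → ℤ,
      ‖X i - X j - latticeVec L n‖ < a} with hK
  rw [← lintegral_const_mul' _ _ (ENNReal.natCast_ne_top m)]
  calc ∫⁻ X in K ∩ cellN N L, (m : ℝ≥0∞) * (‖Ψ.ψ X‖₊ : ℝ≥0∞) ^ 2
      ≤ ∫⁻ X in K ∩ cellN N L, kineticDensity Ψ.ψ X +
          periodicInteraction (fun r => min (v r) (m : ℝ≥0∞)) L X * (‖Ψ.ψ X‖₊ : ℝ≥0∞) ^ 2 := by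
        refine setLIntegral_mono' ((measurableSet_pairImage (S := Set.Iio a) L measurableSet_Iio).inter
          (measurableSet_cellN N L)) fun X hX => ?_
        exact (mul_le_mul' (natCast_le_periodicInteraction_trunc_of_core hcore m L hX.1) le_rfl).trans
          le_add_self
    _ ≤ periodicEnergy (fun r => min (v r) (m : ℝ≥0∞)) Ψ := by
        unfold periodicEnergy
        exact lintegral_mono_set Set.inter_subset_right

/-- One translated sphere in ONE particle's variable is null in configuration space (Fubini in that particle).
[folklore] -/
theorem volume_pairSphere_eq_zero {i j : Fin N} (hij : i ≠ j) (c : Space) (a : ℝ) :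
    volume {X : Config N | ‖X i - X j - c‖ = a} = 0 := by
  classical
  have hf : Measurable fun X : Config N => ‖X i - X j - c‖ :=
    measurable_norm.comp (((measurable_pi_apply (X := fun _ : Fin N => Space) i).sub
      (measurable_pi_apply (X := fun _ : Fin N => Space) j)).sub measurable_const)
  have hTm : MeasurableSet {X : Config N | ‖X i - X j - c‖ = a} :=
    measurableSet_eq_fun (f := fun X : Config N => ‖X i - X j - c‖) (g := fun _ => a) hf measurable_const
  have hfm : Measurable ({X : Config N | ‖X i - X j - c‖ = a}.indicator (1 : Config N → ℝ≥0∞)) :=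
    measurable_one.indicator hTm
  -- integrating particle `i` first kills the indicator: a sphere is null
  have h0 : (∫⋯∫⁻_{i}, {X : Config N | ‖X i - X j - c‖ = a}.indicator 1
      ∂fun _ : Fin N => (volume : Measure Space)) = 0 := by
    rw [lmarginal_singleton]
    funext X
    have hset : (fun x : Space => {X : Config N | ‖X i - X j - c‖ = a}.indicator (1 : Config N → ℝ≥0∞)
        (Function.update X i x)) = (Metric.sphere (X j + c) a).indicator 1 := by
      funext x
      have hiff : Function.update X i x ∈ {X : Config N | ‖X i - X j - c‖ = a} ↔
          x ∈ Metric.sphere (X j + c) a := by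
        simp only [Set.mem_setOf_eq, Function.update_self, Function.update_of_ne hij.symm,
          Metric.mem_sphere, dist_eq_norm, sub_sub]
      by_cases hx : x ∈ Metric.sphere (X j + c) a
      · rw [Set.indicator_of_mem hx, Set.indicator_of_mem (hiff.2 hx)]; rfl
      · rw [Set.indicator_of_notMem hx, Set.indicator_of_notMem (fun h => hx (hiff.1 h))]
    rw [hset, lintegral_indicator_one Metric.isClosed_sphere.measurableSet, Measure.addHaar_sphere]
    rfl
  have huniv : (Finset.univ : Finset (Fin N)) = {i} ∪ Finset.univ.erase i := by
    rw [← Finset.insert_eq, Finset.insert_erase (Finset.mem_univ i)]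
  have hdisj : Disjoint ({i} : Finset (Fin N)) (Finset.univ.erase i) :=
    Finset.disjoint_singleton_left.2 (Finset.notMem_erase i _)
  calc volume {X : Config N | ‖X i - X j - c‖ = a}
      = ∫⁻ X, {X : Config N | ‖X i - X j - c‖ = a}.indicator 1 X := (lintegral_indicator_one hTm).symm
    _ = (∫⋯∫⁻_Finset.univ, {X : Config N | ‖X i - X j - c‖ = a}.indicator 1
          ∂fun _ : Fin N => (volume : Measure Space)) (fun _ => 0) := by
        rw [volume_pi]; exact lintegral_eq_lmarginal_univ _
    _ = (∫⋯∫⁻_{i} ∪ Finset.univ.erase i, {X : Config N | ‖X i - X j - c‖ = a}.indicator 1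
          ∂fun _ : Fin N => (volume : Measure Space)) (fun _ => 0) := by
        rw [← huniv]
    _ = (∫⋯∫⁻_Finset.univ.erase i, ∫⋯∫⁻_{i}, {X : Config N | ‖X i - X j - c‖ = a}.indicator 1
          ∂(fun _ : Fin N => (volume : Measure Space)) ∂fun _ : Fin N => (volume : Measure Space))
          (fun _ => 0) := by
        rw [lmarginal_union' _ _ hfm hdisj]
    _ = 0 := by
        rw [h0]
        simp [lmarginal]

/-- **The wall is Lebesgue-null**: configurations with some image pair at distance EXACTLY `a` form a null set
(countably many translated spheres in one particle's variable, Fubini). [folklore] -/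
theorem volume_wall_eq_zero (N : ℕ) (L a : ℝ) :
    volume {X : Config N | ∃ i j : Fin N, i ≠ j ∧ ∃ n : Fin 3 → ℤ, ‖X i - X j - latticeVec L n‖ = a} = 0 := by
  have h : {X : Config N | ∃ i j : Fin N, i ≠ j ∧ ∃ n : Fin 3 → ℤ, ‖X i - X j - latticeVec L n‖ = a} =
      ⋃ i : Fin N, ⋃ j : Fin N, ⋃ (_ : i ≠ j), ⋃ n : Fin 3 → ℤ,
        {X : Config N | ‖X i - X j - latticeVec L n‖ = a} := by
    ext X; simp only [Set.mem_setOf_eq, Set.mem_iUnion, exists_prop]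
  rw [h]
  refine measure_iUnion_null fun i => measure_iUnion_null fun j => measure_iUnion_null fun hij =>
    measure_iUnion_null fun n => ?_
  exact volume_pairSphere_eq_zero hij _ a

/-- **Closed versus open hard set**: they differ by the null wall, so every set integral over the closed hard set
(some image pair at distance `≤ a`) is at most the one over the open hard set (distance `< a`). [folklore] -/
theorem setLIntegral_hardSet_le_open (N : ℕ) (L a : ℝ) (f : Config N → ℝ≥0∞) :
    ∫⁻ X in {X : Config N | ∃ i j : Fin N, i ≠ j ∧ ∃ n : Fin 3 → ℤ, ‖X i - X j - latticeVec L n‖ ≤ a} ∩ cellN N L, f X ≤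
      ∫⁻ X in {X : Config N | ∃ i j : Fin N, i ≠ j ∧ ∃ n : Fin 3 → ℤ, ‖X i - X j - latticeVec L n‖ < a} ∩ cellN N L, f X := by
  refine lintegral_mono_set' (ae_le_set.2 (measure_mono_null ?_ (volume_wall_eq_zero N L a)))
  rintro X ⟨⟨⟨i, j, hij, n, hn⟩, hXc⟩, hX2⟩
  exact ⟨i, j, hij, n, le_antisymm hn (not_lt.1 fun hlt => hX2 ⟨⟨i, j, hij, n, hlt⟩, hXc⟩)⟩

/-- **The layers shrink to the wall**: `⋂ₖ {some image pair at distance in (a − 1/(k+1), a + 1/(k+1))}` is the wall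
(finitely many image pairs can be that close: pigeonhole along `k`). [folklore] -/
theorem iInter_layer_eq_wall (hL : 0 < L) (a : ℝ) :
    (⋂ k : ℕ, {X : Config N | ∃ i j : Fin N, i ≠ j ∧ ∃ n : Fin 3 → ℤ,
        a - 1 / ((k : ℝ) + 1) < ‖X i - X j - latticeVec L n‖ ∧ ‖X i - X j - latticeVec L n‖ < a + 1 / ((k : ℝ) + 1)}) =
      {X : Config N | ∃ i j : Fin N, i ≠ j ∧ ∃ n : Fin 3 → ℤ, ‖X i - X j - latticeVec L n‖ = a} := by
  ext X
  simp only [Set.mem_iInter, Set.mem_setOf_eq]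
  constructor
  · intro h
    classical
    -- the finite set of candidate triples
    have hfin : ∀ i j : Fin N, {n : Fin 3 → ℤ | ‖(X i - X j) - latticeVec L n‖ ≤ |a| + 1}.Finite :=
      fun i j => finite_latticeVec_near hL (X i - X j) (|a| + 1)
    choose! I J hIJ nn hlo hhi using h
    -- every chosen lattice vector lies in the finite candidate set
    have hmem : ∀ k : ℕ, nn k ∈ (hfin (I k) (J k)).toFinset := by
      intro k
      rw [Set.Finite.mem_toFinset, Set.mem_setOf_eq]
      have h1 := hhi k
      have hk : (1 : ℝ) / ((k : ℝ) + 1) ≤ 1 := by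
        rw [div_le_one (by positivity)]; linarith [(Nat.cast_nonneg k : (0 : ℝ) ≤ k)]
      linarith [le_abs_self a]
    -- the triple-valued sequence takes values in a finite type
    let τ : ℕ → (Fin N × Fin N) × (Fin 3 → ℤ) := fun k => ((I k, J k), nn k)
    have hrange : (Set.range τ).Finite := by
      refine (((Set.finite_univ : (Set.univ : Set (Fin N × Fin N)).Finite).prod
        (Set.finite_iUnion fun p : Fin N × Fin N => hfin p.1 p.2)).subset ?_)
      rintro _ ⟨k, rfl⟩
      refine ⟨Set.mem_univ _, Set.mem_iUnion.2 ⟨(I k, J k), ?_⟩⟩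
      exact (Set.Finite.mem_toFinset _).1 (hmem k)
    haveI : Finite (Set.range τ) := hrange.to_subtype
    obtain ⟨⟨t, ht⟩, hinf⟩ := Finite.exists_infinite_fiber (Set.rangeFactorization τ)
    obtain ⟨⟨i₀, j₀⟩, n₀⟩ := t
    -- infinitely many `k` with `τ k = t`
    have hfreq : ∀ K : ℕ, ∃ k, K ≤ k ∧ τ k = ((i₀, j₀), n₀) := by
      intro K
      by_contra hcon
      push Not at hcon
      apply hinf.not_finite
      refine (Set.finite_lt_nat K).subset ?_
      intro k hk
      simp only [Set.mem_preimage, Set.mem_singleton_iff, Subtype.ext_iff, Set.rangeFactorization_coe] at hk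
      by_contra hge
      exact hcon k (not_lt.1 hge) hk
    refine ⟨i₀, j₀, ?_, n₀, ?_⟩
    · obtain ⟨k, -, hk⟩ := hfreq 0
      have := hIJ k
      simp only [τ, Prod.mk.injEq] at hk
      rwa [hk.1.1, hk.1.2] at this
    · refine le_antisymm ?_ ?_
      · refine le_of_forall_pos_lt_add fun ε hε => ?_
        obtain ⟨K, hK⟩ := exists_nat_one_div_lt hε
        obtain ⟨k, hKk, hk⟩ := hfreq K
        simp only [τ, Prod.mk.injEq] at hk
        have h1 := hhi k
        rw [hk.1.1, hk.1.2, hk.2] at h1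
        have hmono : (1 : ℝ) / ((k : ℝ) + 1) ≤ 1 / ((K : ℝ) + 1) :=
          one_div_le_one_div_of_le (by positivity) (by exact_mod_cast Nat.succ_le_succ hKk)
        linarith
      · refine le_of_forall_pos_lt_add fun ε hε => ?_
        obtain ⟨K, hK⟩ := exists_nat_one_div_lt hε
        obtain ⟨k, hKk, hk⟩ := hfreq K
        simp only [τ, Prod.mk.injEq] at hk
        have h1 := hlo k
        rw [hk.1.1, hk.1.2, hk.2] at h1
        have hmono : (1 : ℝ) / ((k : ℝ) + 1) ≤ 1 / ((K : ℝ) + 1) :=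
          one_div_le_one_div_of_le (by positivity) (by exact_mod_cast Nat.succ_le_succ hKk)
        linarith
  · rintro ⟨i, j, hij, n, hn⟩ k
    refine ⟨i, j, hij, n, ?_, ?_⟩ <;> rw [hn] <;>
      linarith [show (0 : ℝ) < 1 / ((k : ℝ) + 1) by positivity]


end AlphaPhys

/-- **Registered landing stub of this support file** (`stub_alphaPhysCoreMass`, = `AlphaPhys.mul_coreMass_le_energy` with all
binders explicit): the core mass of a state is at most its `min(v,m)`-energy over `m` when `v = ⊤` on `[0,a)`. [folklore] -/
theorem stub_alphaPhysCoreMass :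
    ∀ (N : ℕ) (L : ℝ) (v : ℝ → ℝ≥0∞) (a : ℝ), (∀ r, 0 ≤ r → r < a → v r = ⊤) → ∀ (m : ℕ) (Ψ : PeriodicTrialState N L),
      (m : ℝ≥0∞) * ∫⁻ X in {X : Config N | ∃ i j : Fin N, i ≠ j ∧ ∃ n : Fin 3 → ℤ,
          ‖X i - X j - latticeVec L n‖ < a} ∩ cellN N L, (‖Ψ.ψ X‖₊ : ℝ≥0∞) ^ 2 ≤
        periodicEnergy (fun r => min (v r) (m : ℝ≥0∞)) Ψ :=
  fun _ _ _ _ hcore m Ψ => AlphaPhys.mul_coreMass_le_energy hcore m Ψ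

end Summit.AtomisticToContinuum.BoseEinsteinCondensation.Cruxes.HardCoreExtension.ThirdLawCurrentFloor

end
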